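/-
Copyright: lit-balaban Phase-2 proof seat p09 (gen 9).  Statement-level skeleton of a published paper; no proof claims beyond what
the kernel checks below.
-/
import Literature.MathematicalPhysics.QuantumFieldTheory.BalabanImbrieJaffe1984to88.BIJ85LineSumHk
import Literature.MathematicalPhysics.QuantumFieldTheory.BalabanImbrieJaffe1984to88.BIJ85GaugeFnBound513
import Literature.MathematicalPhysics.QuantumFieldTheory.Balaban1983to89.B3Taylor310LocalRemainder

/-!
# [BalabanImbrieJaffe1985] §7.2 p. 326 *"The gauge transformation λ in (5.1.1) is bounded"*, LOCALLY: the slot `K_λ` of the second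
printed form of (7.3.2) — `|λ_k(H_kB)|` at the two corners of a unit bond for the growth-controlled potential

T. Bałaban, J. Imbrie, A. Jaffe, *Renormalization of the Higgs model: minimizers, propagators and the stability of mean field theory*,
Commun. Math. Phys. **97** (1985) 299–329 [BalabanImbrieJaffe1985].  Rows **C1.Eq7.2.4** (*"(7.2.4) The gauge transformation λ in (5.1.1)
is bounded"*, the estimate used), **C1.Eq7.2.1-7.2.2** (the sup member of (7.2.2)) and **C1.Eq7.3.1-7.3.2** (second printed form of (7.3.2),
where it is consumed) of the lit-balaban skeleton (owner r15, referee ref-5).  Companion of `BIJ85LineSumHk` (slot `K_H`).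

THE PRINTED TEXT, verbatim.  p. 315 [PDF 17] (5.1.13)–(5.1.14): *"λ(A, x) = −Σ_{j=0}^{k−1} L^jη[(Q_jA)(Γ_{x_{j+1},x_j}) − L^{−d}Σ_{x′∈B(x_{j+1})}
(Q_jA)(Γ_{x_{j+1},x′})] (5.1.13) … λ = λ(H_kB, ·) (5.1.14)"*; p. 326 [PDF 28, text layer L2–5]: *"The gauge transformation λ in (5.1.1) is
bounded and depends on B through an exponentially decaying kernel D_k: λ(x) = (D_kB)(x), |D_k(x, b)| ≦ Me^{−δ dist(x,b)}. (7.2.4) This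
estimate follows from (5.1.4) and (7.2.2)."* (v1.1: quotation restored verbatim — v1 condensed it and wrote the kernel as `𝒟_k(b, b′)`;
ref-1 g46 F4-NIT; declarations byte-identical); *"we use (5.1.1) to return the minimizers to Landau gauge. This is a local procedure since
f^{(k)} can locally be represented as a curl."*

WHERE THIS SITS.  p11's `BIJ85LineSumExact.lineSum_bound_of_pieces` reduces the located line-sum constant of the second printed form of
(7.3.2) on exact fields to `K_H` (DONE: `BIJ85LineSumHk`) and `K_Γ` = a bound `|Γ_B| ≤ K_Γ·C` at the two corners `cornerIter k b±` of the
unit bond, `Γ_B = λ_k(H_kB) + D(Q^{e*}_k∂B)` (`gaugeFnExact`).  THIS FILE PROVES THE `λ_k(H_kB)` HALF OF `K_Γ` for the SAME potential as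
`BIJ85LineSumHk` (quadratic growth `C_B` about `b₋`), uniformly in `k` and in the volume: p33's *"λ is bounded"* `norm_lamOf_le_unit'`
(`‖λ(A)(x)‖ ≤ d·sup‖A‖`) is LOCALISED by p33's own `lamOf_congr_tower` (`λ(A)(x)` sees `A` only on the η-bonds of the unit block `B^k(x_k)`),
and on that block the local sup of `H_kB` is `BIJ85LineSumHk.abs_HkE_apply_le_of_growth`; the second corner `b₊` lies in the adjacent block,
at `ℓ¹` distance `1` from `b₋`, which costs a factor `(1 + 1)² = 4` on the growth constant.

WHAT IS PROVED (0 `sorry`, theorems only, no `def`, no new named fact; standard axioms).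
* §1 **`norm_lamOf_le_local`** — *"λ is bounded"* LOCALLY: if `‖A(b′)‖ ≤ a` on the η-bonds `b′` with both endpoints in the unit block `B^k(x_k)`
  then `‖λ_k(A)(x)‖ ≤ d·a` (printed normalisation `c = L^k = η⁻¹`; truncation + `lamOf_congr_tower` + `norm_lamOf_le_unit'`).
* §2 **`abs_HkE_apply_le_of_growth_far`** — the local sup of `H_kB` at ANY fine site for a potential of quadratic growth about an arbitrary
  base `x₀`: `|(H_kB)_κ(z)| ≤ M·C_B·S(δ,d)·(1 + |x₀ − x_k(z)|₁)²` (`(1 + a + D) ≤ (1 + a)(1 + D)` and the `ℓ¹` triangle inequality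
  `B3Taylor310LocalRemainder.tdist_triangle`); **`abs_lamOf_HkE_le_of_growth`**: `|λ_k(H_kB)(x)| ≤ d·M·C_B·S·(1 + |x₀ − x_k|₁)²`.
* §3 the corners: `blk_cornerIter` (`(cornerIter k y)_k = y` read in `T^{(k)}`), `cast_tgt`, `tdist_shift_le_one`; **`abs_lamOf_HkE_corners_le`**:
  for `B` of growth `C_B` about `b₋`, `|λ_k(H_kB)(cornerIter k b₋)| ≤ d·M·C_B·S` and `|λ_k(H_kB)(cornerIter k b₊)| ≤ 4·d·M·C_B·S` — the
  `λ`-summand of p11's `gaugeFnExact` at both corners (`lamE P η⁻¹ k (HkE P η^d η⁻¹ k B)`, `abs_lamE_HkE_corners_le`).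
* §4 **`exists_Klam_allTori`** — ONE `K_λ` FOR ALL TORI, HYPOTHESIS-FREE (`d ≥ 1`, `L` odd `> 1`): on EVERY torus `P` (`P.d = d`, `P.L = L`),
  every scale `1 ≤ k ≤ m + K`, every unit bond `b`, every `B : CoarseSpace P k` of growth `C_B` about `b₋`:
  `|λ_k(H_kB)(cornerIter k b₋)|, |λ_k(H_kB)(cornerIter k b₊)| ≤ K_λ·C_B` (`K_λ = 4dMe^{δ/2}(1+4d/δ)²d(2(1+2d/δ))^d` from the all-tori sup member
  of (7.2.2), p16's `exists_absH_le_allTori_of_prop12Printed` ∘ p19's `prop12Printed_allTori`); per-torus `exists_Klam`.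
HONEST SCOPE.  (i) The `λ_k(H_kB)` half of `K_Γ` only; the `D(Q^{e*}_k∂B)` half ((5.2.7), `D527E`: needs (7.2.3) at every `j < k` — p11's
HANDOFF (γ)) and the harmonic sources (δ) remain; `SecClosedIdx.hT` is NOT discharged.  (ii) Same potential class as `BIJ85LineSumHk` (growth
about `b₋` read in `T^{(k)}`), so both slots are served by ONE `B` (`BIJ85LineSumHk.exists_growth_potential_of_dOne`).  (iii) `U = 1` real
abelian fields; torus; `1 ≤ k ≤ m + K`; weights of record; constants explicit, not optimised; (7.2.2) enters by its `|H|` member at `a = 1`.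
statement-level skeleton of published theorems with citation tags; proofs where landed; nothing here is a claim about the Yang–Mills mass gap.
Unit `lit-balaban-p09` (literature-prover-lit-balaban-p09-g9-0), 2026-08-21; TAKING line HOME/STATUS.md 2026-08-21T22:23:42Z.
-/

open scoped BigOperators RealInnerProductSpace
open Finset

namespace Literature.MathematicalPhysics.QuantumFieldTheory.BalabanImbrieJaffe1984to88.BIJ85LineSumLam

open Balaban1983to89 hiding Site Plaq
open Balaban1983to89.LatticeFieldCalculus hiding runSite runBond
open BIJ85AxialPropagator411 BIJ85Prop521Torus BIJ85Sigma421Torus BIJ85Eq611Torus BIJ85Prop522Torus BIJ85Sigma422Eta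
open BIJ85Sect7Statements BIJ85Ineq722Torus
open BIJ85Ineq722ProofPart2 (settingOf)
open BIJ85Ineq722DeltaA (deltaAData)
open BIJ85Prop12AllTori (prop12Printed_allTori)
open BIJ85Sect72AllTori (exists_absH_le_allTori_of_prop12Printed)
open BIJ85GaugeFunction5113 (blk lamOf)
open BIJ85GaugeFnBound513 (norm_lamOf_le_unit' lamOf_congr_tower)
open BIJ85Prop511Torus (lamE lamE_apply)
open BIJ85BlockAveragesTorusK (blkIter cornerIter blkIter_cornerIter)
open BIJ85LineSumHk (hH_of_kernelBounds abs_HkE_apply_le_of_growth cast_blkIter)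
open Balaban1983to89.B3Taylor310LocalRemainder (tdist_triangle tdist_comm tdist_self)
-- inside this namespace the bare `Site`/`Plaq` are the `ℤ^d` carriers of the QFT root; the torus ones are renamed:
open Balaban1983to89 renaming Site → TSite, Plaq → TPlaq

noncomputable section

variable {P : Params}

/-! ## §1  *"λ is bounded"*, locally -/

/-- **"The gauge transformation λ in (5.1.1) is bounded" — LOCAL form**: if `‖A(b′)‖ ≤ a` for every η-bond `b′` whose two endpoints lie
in the unit block of `x` (`(b′₋)_k = (b′₊)_k = x_k`), then `‖λ_k(A)(x)‖ ≤ d·a` at the printed normalisation `c = L^k = η⁻¹` — p33's global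
bound `norm_lamOf_le_unit'` applied to the truncation of `A` to those bonds, which has the same `λ(·)(x)` by p33's locality
`lamOf_congr_tower` (standing range `k ≤ m + K`). [cite: BalabanImbrieJaffe1985, (7.2.4) p.326] -/
theorem norm_lamOf_le_local {V : Type*} [NormedAddCommGroup V] [NormedSpace ℝ V] {k : ℕ} (hk : k ≤ P.m + P.K)
    (A : VecField P 0 V) {a : ℝ} (ha : 0 ≤ a) (x : TSite P 0)
    (hA : ∀ b : PBond P 0, blk k b.src = blk k x → blk k b.tgt = blk k x → ‖A b‖ ≤ a) :
    ‖lamOf ((P.L : ℝ) ^ k) k A x‖ ≤ P.d * a := by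
  classical
  set A' : VecField P 0 V := fun b => if blk k b.src = blk k x ∧ blk k b.tgt = blk k x then A b else 0 with hA'
  have hcongr : lamOf ((P.L : ℝ) ^ k) k A x = lamOf ((P.L : ℝ) ^ k) k A' x :=
    lamOf_congr_tower hk _ x fun b hs ht => by rw [hA']; exact (if_pos ⟨hs, ht⟩).symm
  have hbd : ∀ b, ‖A' b‖ ≤ a := fun b => by
    show ‖(if blk k b.src = blk k x ∧ blk k b.tgt = blk k x then A b else 0)‖ ≤ a
    by_cases h : blk k b.src = blk k x ∧ blk k b.tgt = blk k x
    · rw [if_pos h]; exact hA b h.1 h.2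
    · rw [if_neg h, norm_zero]; exact ha
  rw [hcongr]
  exact norm_lamOf_le_unit' hk A' hbd x

/-! ## §2  The local sup of `H_kB` away from the base of the growth; `λ_k(H_kB)` -/

/-- **The local sup of `H_kB` at ANY fine site, for a potential of quadratic growth about an arbitrary base `x₀`**: if the columns of `H_k`
obey `|(H_ke_{b′})_κ(z)| ≤ Me^{−δ|x_k(z) − b′₋|₁}` and `|B(b′)| ≤ C_B(1 + |b′₋ − x₀|₁)²`, then
`|(H_kB)_κ(z)| ≤ M·C_B·(1 + 4/δ)²d(2(1 + 2/δ))^d·(1 + |x₀ − x_k(z)|₁)²` — `1 + |b′₋ − x₀|₁ ≤ (1 + |b′₋ − x_k(z)|₁)(1 + |x_k(z) − x₀|₁)` and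
`BIJ85LineSumHk.abs_HkE_apply_le_of_growth` with the constant `C_B(1 + |x_k(z) − x₀|₁)²`. [cite: BalabanImbrieJaffe1985, (7.2.2) p.325] -/
theorem abs_HkE_apply_le_of_growth_far {k : ℕ} (w c : ℝ) {M δ : ℝ} (hM : 0 ≤ M) (hδ : 0 < δ)
    (hH : ∀ (z : TSite P 0) (κ : Fin P.d) (b : PBond P k),
      |WithLp.ofLp (HkE P w c k (toEj P k (Pi.single b 1))) ⟨z, κ⟩| ≤ M * Real.exp (-δ * ((blk k z).tdist b.src : ℝ)))
    (x₀ : TSite P k) (z : TSite P 0) (κ : Fin P.d) {B : PBond P k → ℝ} {CB : ℝ} (hCB : 0 ≤ CB)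
    (hB : ∀ b : PBond P k, |B b| ≤ CB * (1 + (b.src.tdist x₀ : ℝ)) ^ 2) :
    |WithLp.ofLp (HkE P w c k (toEj P k B)) ⟨z, κ⟩| ≤
      M * CB * ((1 + 4 / δ) ^ 2 * ((P.d : ℝ) * (2 * (1 + (δ / 2)⁻¹)) ^ P.d)) * (1 + (x₀.tdist (blk k z) : ℝ)) ^ 2 := by
  set D : ℝ := (x₀.tdist (blk k z) : ℝ) with hD
  have hD0 : 0 ≤ D := Nat.cast_nonneg _
  have hB' : ∀ b : PBond P k, |B b| ≤ CB * (1 + D) ^ 2 * (1 + (b.src.tdist (blk k z) : ℝ)) ^ 2 := by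
    intro b
    have ht : (b.src.tdist x₀ : ℝ) ≤ (b.src.tdist (blk k z) : ℝ) + D := by
      rw [hD, tdist_comm x₀]
      exact_mod_cast tdist_triangle b.src (blk k z) x₀
    have ha0 : 0 ≤ (b.src.tdist (blk k z) : ℝ) := Nat.cast_nonneg _
    have h1 : 1 + (b.src.tdist x₀ : ℝ) ≤ (1 + D) * (1 + (b.src.tdist (blk k z) : ℝ)) := by nlinarith
    calc |B b| ≤ CB * (1 + (b.src.tdist x₀ : ℝ)) ^ 2 := hB b
      _ ≤ CB * ((1 + D) * (1 + (b.src.tdist (blk k z) : ℝ))) ^ 2 :=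
          mul_le_mul_of_nonneg_left (pow_le_pow_left₀ (by positivity) h1 2) hCB
      _ = CB * (1 + D) ^ 2 * (1 + (b.src.tdist (blk k z) : ℝ)) ^ 2 := by ring
  have h := abs_HkE_apply_le_of_growth w c hM hδ hH z κ (by positivity) hB'
  calc _ ≤ M * (CB * (1 + D) ^ 2) * ((1 + 4 / δ) ^ 2 * ((P.d : ℝ) * (2 * (1 + (δ / 2)⁻¹)) ^ P.d)) := h
    _ = _ := by ring

/-- **`|λ_k(H_kB)(x)| ≤ d·M·C_B·S(δ,d)·(1 + |x₀ − x_k|₁)²`** for a potential `B` of quadratic growth `C_B` about `x₀` (printed normalisation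
`c = L^k`; `S(δ,d) = (1 + 4/δ)²d(2(1 + 2/δ))^d`): §1 on the unit block of `x`, where every fine site `z` has `x_k(z) = x_k` and §2 gives the
sup. [cite: BalabanImbrieJaffe1985, (7.2.4) p.326] -/
theorem abs_lamOf_HkE_le_of_growth {k : ℕ} (hk : k ≤ P.m + P.K) (w c : ℝ) {M δ : ℝ} (hM : 0 ≤ M) (hδ : 0 < δ)
    (hH : ∀ (z : TSite P 0) (κ : Fin P.d) (b : PBond P k),
      |WithLp.ofLp (HkE P w c k (toEj P k (Pi.single b 1))) ⟨z, κ⟩| ≤ M * Real.exp (-δ * ((blk k z).tdist b.src : ℝ)))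
    (x₀ : TSite P k) {B : PBond P k → ℝ} {CB : ℝ} (hCB : 0 ≤ CB)
    (hB : ∀ b : PBond P k, |B b| ≤ CB * (1 + (b.src.tdist x₀ : ℝ)) ^ 2) (x : TSite P 0) :
    |lamOf ((P.L : ℝ) ^ k) k (WithLp.ofLp (HkE P w c k (toEj P k B))) x| ≤
      P.d * (M * CB * ((1 + 4 / δ) ^ 2 * ((P.d : ℝ) * (2 * (1 + (δ / 2)⁻¹)) ^ P.d)) * (1 + (x₀.tdist (blk k x) : ℝ)) ^ 2) := by
  rw [← Real.norm_eq_abs]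
  refine norm_lamOf_le_local hk _ (by positivity) x fun b hs _ => ?_
  rw [Real.norm_eq_abs]
  have h := abs_HkE_apply_le_of_growth_far w c hM hδ hH x₀ b.src b.dir hCB hB
  rw [hs] at h
  exact h

/-! ## §3  The two corners of a unit bond -/

/-- kernel: casting a site along an equality of levels commutes with `shift`. [folklore] -/
private theorem cast_shift {n n' : ℕ} (e : n = n') (z : TSite P n) (μ : Fin P.d) :
    cast (congrArg (Balaban1983to89.Site P) e) (z.shift μ) = (cast (congrArg (Balaban1983to89.Site P) e) z).shift μ := by
  subst e; rfl

/-- **the corner point of the unit site `y` has `k`-block `y`** (read in `T^{(k)}`): `blk k (cornerIter k y) = cast y` — p11's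
`blkIter_cornerIter` through `BIJ85LineSumHk.cast_blkIter` (standing range). [cite: BalabanImbrieJaffe1985, (5.1.2)–(5.1.3) p.313] -/
theorem blk_cornerIter {k : ℕ} (hk : k ≤ P.m + P.K) (y : TSite P (0 + k)) :
    blk k (cornerIter k y) = cast (congrArg (Balaban1983to89.Site P) (Nat.zero_add k)) y := by
  rw [← cast_blkIter, blkIter_cornerIter k (by simpa using hk) y]

/-- kernel: the far endpoint of a unit bond, read in `T^{(k)}`, is the shift of the near one. [folklore] -/
private theorem cast_tgt {k : ℕ} (b : PBond P (0 + k)) :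
    cast (congrArg (Balaban1983to89.Site P) (Nat.zero_add k)) b.tgt =
      (cast (congrArg (Balaban1983to89.Site P) (Nat.zero_add k)) b.src).shift b.dir :=
  cast_shift (Nat.zero_add k) b.src b.dir

/-- kernel: `(t : ZMod n).val ≤ t`. [folklore] -/
private theorem val_natCast_le {n : ℕ} [NeZero n] (t : ℕ) : ((t : ZMod n)).val ≤ t := by
  rw [ZMod.val_natCast]; exact Nat.mod_le _ _

/-- kernel: nearest neighbours are at `ℓ¹` torus distance at most one, `|x − (x + e_μ)|₁ ≤ 1`. [folklore] -/
private theorem tdist_shift_le_one {j : ℕ} (x : TSite P j) (μ : Fin P.d) : x.tdist (x.shift μ) ≤ 1 := by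
  unfold Balaban1983to89.Site.tdist
  have h1 : ∀ ν : Fin P.d, min (x ν - x.shift μ ν).val (x.shift μ ν - x ν).val ≤ if ν = μ then 1 else 0 := by
    intro ν
    by_cases h : ν = μ
    · subst h
      simp only [Balaban1983to89.Site.shift, Function.update_self, add_sub_cancel_left, if_true]
      calc min (x ν - (x ν + 1)).val (1 : ZMod (P.sitesPerDir j)).val ≤ (1 : ZMod (P.sitesPerDir j)).val := min_le_right _ _
        _ = ((1 : ℕ) : ZMod (P.sitesPerDir j)).val := by rw [Nat.cast_one]
        _ ≤ 1 := val_natCast_le 1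
    · simp [Balaban1983to89.Site.shift, h]
  calc ∑ ν : Fin P.d, min (x ν - x.shift μ ν).val (x.shift μ ν - x ν).val
      ≤ ∑ ν : Fin P.d, (if ν = μ then 1 else 0) := Finset.sum_le_sum fun ν _ => h1 ν
    _ = 1 := by simp

/-- **`λ_k(H_kB)` AT THE TWO CORNERS OF THE UNIT BOND `b`** (one torus, one scale `k ≤ m + K`, kernel shape `hH` with constants `(M, δ)`,
printed normalisation `c = L^k`): for every unit-lattice bond field `B` of quadratic growth `C_B` about `b₋` (read in `T^{(k)}`),
`|λ_k(H_kB)(cornerIter k b₋)| ≤ d·M·C_B·S(δ,d)` and `|λ_k(H_kB)(cornerIter k b₊)| ≤ 4·d·M·C_B·S(δ,d)` — the corner of `b₋` lies in the block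
`b₋` (`blk_cornerIter`), the corner of `b₊` in the adjacent block at `ℓ¹` distance `≤ 1`. [cite: BalabanImbrieJaffe1985, (7.2.4) p.326] -/
theorem abs_lamOf_HkE_corners_le {k : ℕ} (hk : k ≤ P.m + P.K) (w c : ℝ) {M δ : ℝ} (hM : 0 ≤ M) (hδ : 0 < δ)
    (hH : ∀ (z : TSite P 0) (κ : Fin P.d) (b' : PBond P k),
      |WithLp.ofLp (HkE P w c k (toEj P k (Pi.single b' 1))) ⟨z, κ⟩| ≤ M * Real.exp (-δ * ((blk k z).tdist b'.src : ℝ)))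
    (b : PBond P (0 + k)) {B : PBond P k → ℝ} {CB : ℝ} (hCB : 0 ≤ CB)
    (hB : ∀ b' : PBond P k,
      |B b'| ≤ CB * (1 + (b'.src.tdist (cast (congrArg (Balaban1983to89.Site P) (Nat.zero_add k)) b.src) : ℝ)) ^ 2) :
    |lamOf ((P.L : ℝ) ^ k) k (WithLp.ofLp (HkE P w c k (toEj P k B))) (cornerIter k b.src)| ≤
        P.d * (M * CB * ((1 + 4 / δ) ^ 2 * ((P.d : ℝ) * (2 * (1 + (δ / 2)⁻¹)) ^ P.d))) ∧
      |lamOf ((P.L : ℝ) ^ k) k (WithLp.ofLp (HkE P w c k (toEj P k B))) (cornerIter k b.tgt)| ≤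
        4 * (P.d * (M * CB * ((1 + 4 / δ) ^ 2 * ((P.d : ℝ) * (2 * (1 + (δ / 2)⁻¹)) ^ P.d)))) := by
  set x₀ : TSite P k := cast (congrArg (Balaban1983to89.Site P) (Nat.zero_add k)) b.src with hx₀
  set S : ℝ := (1 + 4 / δ) ^ 2 * ((P.d : ℝ) * (2 * (1 + (δ / 2)⁻¹)) ^ P.d) with hS
  have hsrc := abs_lamOf_HkE_le_of_growth hk w c hM hδ hH x₀ hCB hB (cornerIter k b.src)
  have htgt := abs_lamOf_HkE_le_of_growth hk w c hM hδ hH x₀ hCB hB (cornerIter k b.tgt)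
  rw [blk_cornerIter hk, ← hx₀, tdist_self, Nat.cast_zero, add_zero, one_pow, mul_one] at hsrc
  rw [blk_cornerIter hk, cast_tgt, ← hx₀] at htgt
  refine ⟨hsrc, htgt.trans ?_⟩
  have h1 : (1 + (x₀.tdist (x₀.shift b.dir) : ℝ)) ^ 2 ≤ 4 := by
    have h2 : (x₀.tdist (x₀.shift b.dir) : ℝ) ≤ 1 := by exact_mod_cast tdist_shift_le_one x₀ b.dir
    have h3 : (0 : ℝ) ≤ (x₀.tdist (x₀.shift b.dir) : ℝ) := Nat.cast_nonneg _
    nlinarith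
  have h0 : 0 ≤ P.d * (M * CB * S) := by positivity
  calc P.d * (M * CB * S * (1 + (x₀.tdist (x₀.shift b.dir) : ℝ)) ^ 2)
      = P.d * (M * CB * S) * (1 + (x₀.tdist (x₀.shift b.dir) : ℝ)) ^ 2 := by ring
    _ ≤ P.d * (M * CB * S) * 4 := mul_le_mul_of_nonneg_left h1 h0
    _ = 4 * (P.d * (M * CB * S)) := by ring

/-- **The same for the `λ`-summand of p11's `gaugeFnExact`** — `lamE P η⁻¹ k (HkE P η^d η⁻¹ k B)` at the two corners, `B : CoarseSpace P k` of
growth `C_B` about `b₋`: both values are `≤ 4·d·M·C_B·S(δ,d)` in absolute value (`η⁻¹ = L^k`, `lamE = toLp ∘ lamOf ∘ ofLp`).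
[cite: BalabanImbrieJaffe1985, (7.2.4) p.326] -/
theorem abs_lamE_HkE_corners_le {k : ℕ} (hk : k ≤ P.m + P.K) {M δ : ℝ} (hM : 0 ≤ M) (hδ : 0 < δ)
    (hH : ∀ (z : TSite P 0) (κ : Fin P.d) (b' : PBond P k),
      |WithLp.ofLp (HkE P ((P.eta k) ^ P.d) (P.eta k)⁻¹ k (toEj P k (Pi.single b' 1))) ⟨z, κ⟩| ≤
        M * Real.exp (-δ * ((blk k z).tdist b'.src : ℝ)))
    (b : PBond P (0 + k)) {B : CoarseSpace P k} {CB : ℝ} (hCB : 0 ≤ CB)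
    (hB : ∀ b' : PBond P k,
      |WithLp.ofLp B b'| ≤ CB * (1 + (b'.src.tdist (cast (congrArg (Balaban1983to89.Site P) (Nat.zero_add k)) b.src) : ℝ)) ^ 2) :
    |lamE P (P.eta k)⁻¹ k (HkE P ((P.eta k) ^ P.d) (P.eta k)⁻¹ k B) (cornerIter k b.src)| ≤
        4 * (P.d * (M * CB * ((1 + 4 / δ) ^ 2 * ((P.d : ℝ) * (2 * (1 + (δ / 2)⁻¹)) ^ P.d)))) ∧
      |lamE P (P.eta k)⁻¹ k (HkE P ((P.eta k) ^ P.d) (P.eta k)⁻¹ k B) (cornerIter k b.tgt)| ≤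
        4 * (P.d * (M * CB * ((1 + 4 / δ) ^ 2 * ((P.d : ℝ) * (2 * (1 + (δ / 2)⁻¹)) ^ P.d)))) := by
  obtain ⟨h1, h2⟩ := abs_lamOf_HkE_corners_le hk ((P.eta k) ^ P.d) (P.eta k)⁻¹ hM hδ hH b hCB hB
  have e : toEj P k (WithLp.ofLp B) = B := rfl
  rw [e, ← eta_inv] at h1 h2
  have h0 : 0 ≤ P.d * (M * CB * ((1 + 4 / δ) ^ 2 * ((P.d : ℝ) * (2 * (1 + (δ / 2)⁻¹)) ^ P.d))) := by positivity
  refine ⟨?_, ?_⟩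
  · rw [lamE_apply]
    exact h1.trans (by linarith)
  · rw [lamE_apply]
    exact h2

/-! ## §4  ALL TORI: one `K_λ`, hypothesis-free -/

/-- **ONE `K_λ` FOR ALL TORI, HYPOTHESIS-FREE**: for every dimension `d ≥ 1` and block size `L` (odd, `> 1`) there is `K_λ ≥ 0` such that on
EVERY torus `P` with `P.d = d`, `P.L = L` (any volume, any number of steps), at every scale `1 ≤ k ≤ m + K`, for every unit bond `b` and
every `B : CoarseSpace P k` of quadratic growth `C_B` about `b₋`: the `λ`-summand `λ_k(H_kB)` of the gauge function `Γ_B` of p11's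
`lineSum_TkF_exact` is `≤ K_λ·C_B` in absolute value at BOTH corners `cornerIter k b₋`, `cornerIter k b₊` — *"The gauge transformation λ in
(5.1.1) is bounded"*, uniformly in `k` and in `T_η`, made local.  Input: the `|H|` member of (7.2.2) over all tori (p16's
`exists_absH_le_allTori_of_prop12Printed` ∘ p19's `prop12Printed_allTori`); `K_λ = 4dMe^{δ/2}(1 + 4d/δ)²d(2(1 + 2d/δ))^d`.
[cite: BalabanImbrieJaffe1985, (7.2.4) p.326; Balaban1984PropagatorsI, Prop. 1.2 (1.110)–(1.114) pp.35–36] -/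
theorem exists_Klam_allTori {d L : ℕ} (hd : 1 ≤ d) (hL : Odd L ∧ 1 < L) :
    ∃ Klam : ℝ, 0 ≤ Klam ∧ ∀ (P : Params), P.d = d → P.L = L → ∀ (k : ℕ), 1 ≤ k → ∀ (hk : k ≤ P.m + P.K)
      (b : PBond P (0 + k)) (B : CoarseSpace P k) (CB : ℝ), 0 ≤ CB →
      (∀ b' : PBond P k,
        |WithLp.ofLp B b'| ≤ CB * (1 + (b'.src.tdist (cast (congrArg (Balaban1983to89.Site P) (Nat.zero_add k)) b.src) : ℝ)) ^ 2) →
      |lamE P (P.eta k)⁻¹ k (HkE P ((P.eta k) ^ P.d) (P.eta k)⁻¹ k B) (cornerIter k b.src)| ≤ Klam * CB ∧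
      |lamE P (P.eta k)⁻¹ k (HkE P ((P.eta k) ^ P.d) (P.eta k)⁻¹ k B) (cornerIter k b.tgt)| ≤ Klam * CB := by
  obtain ⟨δ, M, hδ, hM1, hH⟩ := exists_absH_le_allTori_of_prop12Printed hd hL one_pos (prop12Printed_allTori d L one_pos)
  have hM : 0 ≤ M := zero_le_one.trans hM1
  have hd0 : (0 : ℝ) < d := by exact_mod_cast hd
  refine ⟨4 * (d * (M * Real.exp (δ / 2) * ((1 + 4 / (δ / d)) ^ 2 * ((d : ℝ) * (2 * (1 + (δ / d / 2)⁻¹)) ^ d)))),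
    by positivity, ?_⟩
  intro P hPd hPL k hk1 hk b B CB hCB hB
  subst hPd
  have hHk : ∀ (z : TSite P 0) (κ : Fin P.d) (b' : PBond P k),
      |WithLp.ofLp (HkE P ((P.eta k) ^ P.d) (P.eta k)⁻¹ k (toEj P k (Pi.single b' 1))) ⟨z, κ⟩| ≤
        M * Real.exp (δ / 2) * Real.exp (-(δ / P.d) * ((blk k z).tdist b'.src : ℝ)) := fun z κ b' =>
    hH_of_kernelBounds hk (inv_ne_zero (eta_pos P k).ne') (pow_pos (eta_pos P k) _) one_pos hδ.le hM
      (fun μ ν x y => hH P rfl hPL k hk1 hk μ ν x y) z κ b'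
  obtain ⟨h1, h2⟩ := abs_lamE_HkE_corners_le hk (by positivity) (div_pos hδ hd0) hHk b hCB hB
  constructor
  · refine h1.trans (le_of_eq ?_); ring
  · refine h2.trans (le_of_eq ?_); ring

/-- **Per-torus unpacking** (same constant at `(P.d, P.L)`). [cite: BalabanImbrieJaffe1985, (7.2.4) p.326] -/
theorem exists_Klam (P : Params) :
    ∃ Klam : ℝ, 0 ≤ Klam ∧ ∀ (k : ℕ), 1 ≤ k → ∀ (hk : k ≤ P.m + P.K)
      (b : PBond P (0 + k)) (B : CoarseSpace P k) (CB : ℝ), 0 ≤ CB →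
      (∀ b' : PBond P k,
        |WithLp.ofLp B b'| ≤ CB * (1 + (b'.src.tdist (cast (congrArg (Balaban1983to89.Site P) (Nat.zero_add k)) b.src) : ℝ)) ^ 2) →
      |lamE P (P.eta k)⁻¹ k (HkE P ((P.eta k) ^ P.d) (P.eta k)⁻¹ k B) (cornerIter k b.src)| ≤ Klam * CB ∧
      |lamE P (P.eta k)⁻¹ k (HkE P ((P.eta k) ^ P.d) (P.eta k)⁻¹ k B) (cornerIter k b.tgt)| ≤ Klam * CB := by
  obtain ⟨Klam, hKlam, hall⟩ := exists_Klam_allTori (d := P.d) (L := P.L) P.hd P.hL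
  exact ⟨Klam, hKlam, fun k hk1 hk b B CB hCB hB => hall P rfl rfl k hk1 hk b B CB hCB hB⟩

end

end Literature.MathematicalPhysics.QuantumFieldTheory.BalabanImbrieJaffe1984to88.BIJ85LineSumLam
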